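import Summits.NavierStokesRegularity.NavierStokesRegularity.Theses.TypeILiouville
import Literature.Analysis.FluidPDE.LocalTypeI
import HarnessLib

/-!
# `TypeIliouvilleNoTypeII` (stmt-NavierStokesRegularity-0056) — line `energy-split`
# (crux-strategist WALL-BREAKER, generation p1, 2026-08-17), registered skeleton

The crux (`NoTypeII`, shared by 15 `closes`): a maximal smooth solution of Navier–Stokes on
`ℝ³ × [0, T)` which is Leray–Hopf from a rapidly decaying datum blows up at the sup-norm Type-I rate.

THE LINE IS A BYPASS, NOT A RATE BOUND (census `Cruxes/TypeIliouvilleNoTypeII/STRATEGY-CENSUS.md`,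
gen p1, §3): four leads, the disprover, two triage panels and the s1 strategists established that every
line ending in an a-priori UPPER bound on a blow-up rate is dead.  This skeleton ends elsewhere: it cuts
the Type-I/Type-II dichotomy in the ENERGY sense of Seregin (`g₀ < ∞`) / Albritton–Barker 2019
(`𝐈(Q) = sup_{Q' ⊆ Q}(A + C + D + E)(Q') < ∞`, tree `Literature.Analysis.FluidPDE.typeIBound`) and proves
the crux VACUOUSLY — under the three stubs no finite-energy blow-up from Schwartz data exists:

* STUB 1 `stub_energyTypeISingularPoint` — RESIDUAL, OPEN (Seregin's question for ONE point): every
  maximal Leray–Hopf solution from a rapidly decaying datum has a backward singular point `(T, x₀)` with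
  `𝐈(Q((T,x₀), r)) < ⊤` for some `r > 0`.  STRICTLY WEAKER than the crux given finite energy
  (Leslie–Shvydkoy 2018 Thm 1.2 + Albritton–Barker Lemma 2.6); the literature's native form; Seregin's
  scenario exclusions (arXiv:2304.04045, arXiv:2606.29468) bear on it verbatim.
* STUB 2 `stub_noLocalTypeISingularity` — OPEN but NOT NEW WORK: verbatim the shared item
  stmt-NavierStokesRegularity-10480 (`StretchingWellBinding.NoLocalTypeISingularity`, registered skeleton
  `stub_typeIZoom` / `stub_typeILiouville`), `Iff.rfl`-equal to `¬ LocalTypeISingularityExists`; in route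
  TypeILiouville it follows from item #3 (L) via `AlbrittonBarkerForward` (named fact) and the tree's
  `LiouvilleConjectureNS.not_nontrivialMildAncientTypeIExists_measurable`.
* STUB 3 `stub_localTypeIOfEnergyTypeIPoint` — PROVABLE NOW (bookkeeping, ≈ TypeIBridge stmt-10521
  minus its steps (2), (4)): an energy-Type-I backward singular point of a maximal Leray–Hopf classical
  solution yields a local Type-I singular point in Albritton–Barker's sense after the `ν ↦ 1` rescaling
  `v(s,y) = u(νs, νy)` and with the normalised pressure `p_CZ = R_iR_j(u_iu_j)` (the given `p` is
  `p_CZ + c(t)`; `𝐈`'s `D`-term is mean-free; `p_CZ ∈ L^{5/3}_{t,x}`; classical ⇒ suitable weak in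
  backward balls; `∇u ∈ L²`; `typeIBound_mono`).

Composition `TypeIliouvilleNoTypeII_of` = STUB 1 → STUB 2 → STUB 3 → crux (by name), kernel-checked;
the same three statements decide the route's thesis (`Cruxes/…/EnergySplit.lean`,
`typeIliouvilleThesis_of_energySplit`).  Expected lead outcome, stated up front: land STUB 3, record
STUB 2 ≡ stmt-10480, promote STUB 1 (the residue of the wall, one notch below the sup-rate crux).
-/

noncomputable section

-- the summit and its single problem share the name `NavierStokesRegularity` (D-0017 nested layout)
set_option linter.dupNamespace false

open Set Function Filter Topology MeasureTheory Metric
open scoped NNReal ENNReal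

namespace Summit.NavierStokesRegularity.NavierStokesRegularity.Cruxes.TypeIliouvilleNoTypeII.EnergySplit

open Literature.Analysis Literature.Analysis.FluidPDE

/-- `ℝ³`. -/
local notation "E3" => EuclideanSpace ℝ (Fin 3)

/-! ## Stubs -/

/-- STUB 1 — RESIDUAL, OPEN (`EnergyTypeISingularPoint`).  Every maximal smooth solution with finite
lifespan `T` which is Leray–Hopf from a rapidly decaying datum has a backward singular point `(T, x₀)`
that is Type I in the ENERGY sense: Albritton–Barker's `𝐈` is finite on some backward parabolic ball
`Q((T, x₀), r)`.  Strictly weaker than the crux given finite energy (Type I in time ⇒ Type I in space,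
Leslie–Shvydkoy arXiv:1705.04420 Thm 1.2; `A` bounded ⇒ `𝐈 < ∞`, Albritton–Barker arXiv:1811.00502
Lemma 2.6); Seregin's open question (arXiv:2606.29468 p. 3) for one point. -/
theorem stub_energyTypeISingularPoint (ν T : ℝ) (hν : 0 < ν) (hT : 0 < T) (u : ℝ → E3 → E3)
    (p : ℝ → E3 → ℝ) (hmax : IsMaximalSmoothSolution ν 0 u p T)
    (hLH : IsLerayHopfOn T ν 0 (u 0) u) (hdec : HasRapidSpatialDecay (u 0)) :
    ∃ x₀ : E3, IsBackwardSingularPoint u (T, x₀) ∧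
      ∃ r : ℝ, 0 < r ∧ typeIBound (parabolicCylinder r (T, x₀)) u p (fun t y => fderiv ℝ (u t) y) < ⊤ := by
  sorry

/-- STUB 2 — OPEN, SHARED (`NoLocalTypeISingularity`, verbatim item stmt-NavierStokesRegularity-10480 of
route StretchingWellBinding; `Iff.rfl`-equal to `¬ LocalTypeISingularityExists`).  No suitable weak
solution (ν = 1) in a parabolic ball has its centre as a backward singular point with Albritton–Barker's
`𝐈 < ∞`.  Implied by the KNSS Liouville conjecture (L) (item `TypeIliouvilleL`) through Albritton–Barker's
forward theorem. -/
theorem stub_noLocalTypeISingularity :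
    ¬ ∃ (r₀ : ℝ) (z : ℝ × E3) (u : ℝ → E3 → E3) (p : ℝ → E3 → ℝ), IsLocalTypeISingularPoint r₀ z u p := by
  sorry

/-- STUB 3 — PROVABLE NOW (`LocalTypeIOfEnergyTypeIPoint`, bookkeeping).  A maximal Leray–Hopf classical
solution from a rapidly decaying datum with an energy-Type-I backward singular point `(T, x₀)` yields a
local Type-I singular point in Albritton–Barker's printed sense (`ν = 1`): rescale `v(s,y) = u(νs, νy)`,
normalise the pressure to `R_iR_j(u_iu_j)` (differs from `p` by `c(t)`, invisible to the mean-free `D`;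
in `L^{5/3}_{t,x}` by the energy class), classical ⇒ suitable weak in the backward ball with weak gradient
`∇v ∈ L²`, and transport backward singularity and `𝐈 < ⊤` through the rescaling (`typeIBound_mono`). -/
theorem stub_localTypeIOfEnergyTypeIPoint (ν T : ℝ) (hν : 0 < ν) (hT : 0 < T) (u : ℝ → E3 → E3)
    (p : ℝ → E3 → ℝ) (hmax : IsMaximalSmoothSolution ν 0 u p T)
    (hLH : IsLerayHopfOn T ν 0 (u 0) u) (hdec : HasRapidSpatialDecay (u 0))
    (hI : ∃ x₀ : E3, IsBackwardSingularPoint u (T, x₀) ∧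
      ∃ r : ℝ, 0 < r ∧ typeIBound (parabolicCylinder r (T, x₀)) u p (fun t y => fderiv ℝ (u t) y) < ⊤) :
    ∃ (r₀ : ℝ) (z : ℝ × E3) (v : ℝ → E3 → E3) (q : ℝ → E3 → ℝ), IsLocalTypeISingularPoint r₀ z v q := by
  sorry

/-! ## Composition -/

/-- **The crux from the stubs** (`TypeIliouvilleNoTypeII`, concluded BY NAME).  For a maximal Leray–Hopf
solution from a rapidly decaying datum, STUB 1 gives an energy-Type-I backward singular point, STUB 3
turns it into a local Type-I singular point, STUB 2 forbids it: the hypotheses are contradictory, so the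
Type-I rate holds (vacuously — the three stubs decide the route's thesis NoBlowup, see
`Cruxes/TypeIliouvilleNoTypeII/EnergySplit.lean`). -/
theorem TypeIliouvilleNoTypeII_of :
    Summit.NavierStokesRegularity.NavierStokesRegularity.Theses.TypeILiouville.TypeIliouvilleNoTypeII := by
  intro ν T hν hT u p hmax hLH hdec
  exact absurd
    (stub_localTypeIOfEnergyTypeIPoint ν T hν hT u p hmax hLH hdec
      (stub_energyTypeISingularPoint ν T hν hT u p hmax hLH hdec))
    stub_noLocalTypeISingularity

end Summit.NavierStokesRegularity.NavierStokesRegularity.Cruxes.TypeIliouvilleNoTypeII.EnergySplit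

end
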